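import Literature.NumberTheory.Sieve.FGKMT2018DkBoxClasses
import HarnessLib

/-!
# FGKMT 2018 Theorem 6 / Maynard 2016 Prop. 9.1: the change of variables (9.2)

Sources: J. Maynard, *Dense clusters of primes in subsets*, Compositio Math. 152 (2016) =
arXiv:1405.2593 [Maynard2016DenseClusters], proof of Proposition 9.1 p. 19, display (9.2)
(«We substitute our expression (8.6) for `λ_d` in terms of `y_r` to give
`∑'_{d,e} λ_dλ_e/[d,e] = ∑_{r,s ∈ 𝒟_k} (y_r y_s/(φ_ω(r)φ_ω(s))) ∑'_{d|r, e|s} μ(d)μ(e)de/[d,e]`»),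
§7 (8.6) p. 14; K. Ford, B. Green, S. Konyagin, J. Maynard, T. Tao, *Long gaps between primes*,
JAMS 31 (2018) = arXiv:1412.5029v4 [FordGreenKonyaginMaynardTao2018], (7.7) p. 21.

PROVED here (no named facts), for the pinned `dkBox`/`lamVar`/`yVar` and ANY `F`:

* `mem_dkBox_of_dvd` — `𝒟_k(𝓛)` is divisor-closed: `r ∈ 𝒟_k`, `dᵢ ∣ rᵢ ∀i ⇒ d ∈ 𝒟_k`;
  `filter_dvd_eq_piFinset_divisors` — `{d ∈ 𝒟_k : d ∣ r} = ∏ᵢ divisors(rᵢ)` for `r ∈ 𝒟_k`;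
* `localPairSum` — `T(r,s) = ∑'_{d ∣ r, e ∣ s} μ(d)μ(e) d e/∏[dᵢ,eᵢ]` (the inner sum of (9.2),
  `∑'` = cross-coprime pairs, `d = ∏dᵢ`);
* **`quadForm_eq_sum_yVar`** — display (9.2):
  `∑_{d,e ∈ 𝒟_k} [cross] λ_dλ_e/∏[dᵢ,eᵢ] = ∑_{r,s ∈ 𝒟_k} y_r y_s/(φ_ω(r)φ_ω(s)) · T(r,s)`.

What remains of the main term of Proposition 9.1 after this file is the EVALUATION
`T(r,s) = ∏_{p ∣ rs} S_p(r,s)`, `S_p ∈ {p − 1, −1, 0}` (display (9.5)), then (9.3)–(9.4) with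
Lemma 8.2 (ii) and Lemma 8.4.

## References
* J. Maynard, *Dense clusters of primes in subsets*, Compositio Math. 152 (2016), (8.6), (9.2)
  [Maynard2016DenseClusters].
* K. Ford, B. Green, S. Konyagin, J. Maynard, T. Tao, *Long gaps between primes*, JAMS 31 (2018),
  (7.7) [FordGreenKonyaginMaynardTao2018].
-/

noncomputable section

open Finset
open scoped ArithmeticFunction.Moebius

namespace Literature.NumberTheory.Sieve.FGKMT2018

variable {k : ℕ}

/-! ### `𝒟_k(𝓛)` is divisor-closed -/

/-- `𝒟_k(𝓛)` is closed under coordinatewise divisors.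
[cite: Maynard2016DenseClusters, §7 p. 13–14 (definition of 𝒟_k, (8.6)); FordGreenKonyaginMaynardTao2018, (7.5) p. 21] -/
theorem mem_dkBox_of_dvd {L : Fin k → ℤ × ℤ} {B : ℕ} {R : ℝ} {r d : Fin k → ℕ}
    (hr : r ∈ dkBox L B R) (hd : ∀ i, d i ∣ r i) : d ∈ dkBox L B R := by
  classical
  have hr' := hr
  unfold dkBox at hr' ⊢
  obtain ⟨hrbox, hrsq, hrcop, hridx⟩ := Finset.mem_filter.1 hr'
  have hr1 : ∀ i, 1 ≤ r i := fun i => (Finset.mem_Icc.1 (Fintype.mem_piFinset.1 hrbox i)).1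
  have hd0 : ∀ i, d i ≠ 0 := fun i h0 => by
    have := hd i; rw [h0, zero_dvd_iff] at this; exact absurd this (Nat.one_le_iff_ne_zero.1 (hr1 i))
  have hprod : (∏ i, d i) ∣ ∏ i, r i := Finset.prod_dvd_prod_of_dvd _ _ fun i _ => hd i
  refine Finset.mem_filter.2 ⟨?_, ?_, ?_, ?_⟩
  · refine Fintype.mem_piFinset.2 fun i => Finset.mem_Icc.2 ⟨Nat.one_le_iff_ne_zero.2 (hd0 i), ?_⟩
    exact (Nat.le_of_dvd (hr1 i) (hd i)).trans (Finset.mem_Icc.1 (Fintype.mem_piFinset.1 hrbox i)).2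
  · exact Squarefree.squarefree_of_dvd hprod hrsq
  · exact Nat.Coprime.coprime_dvd_left hprod hrcop
  · intro j p hp
    have hpr : p ∈ (r j).primeFactors :=
      Nat.mem_primeFactors.2 ⟨Nat.prime_of_mem_primeFactors hp,
        (Nat.dvd_of_mem_primeFactors hp).trans (hd j), Nat.one_le_iff_ne_zero.1 (hr1 j)⟩
    exact hridx j p hpr

/-- For `r ∈ 𝒟_k(𝓛)`: `{d ∈ 𝒟_k(𝓛) : dᵢ ∣ rᵢ ∀i} = ∏ᵢ divisors(rᵢ)` (so the inner sums of (8.6),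
(9.2) are sums over all coordinatewise divisors). [cite: Maynard2016DenseClusters, (8.6) p. 14, (9.2) p. 19] -/
theorem filter_dvd_eq_piFinset_divisors {L : Fin k → ℤ × ℤ} {B : ℕ} {R : ℝ} {r : Fin k → ℕ}
    (hr : r ∈ dkBox L B R) :
    (dkBox L B R).filter (fun d => ∀ i, d i ∣ r i) = Fintype.piFinset fun i => (r i).divisors := by
  classical
  ext d
  simp only [Finset.mem_filter, Fintype.mem_piFinset, Nat.mem_divisors]
  constructor
  · rintro ⟨-, hd⟩ i
    exact ⟨hd i, Nat.one_le_iff_ne_zero.1 (one_le_of_mem_dkBox hr i)⟩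
  · intro h
    exact ⟨mem_dkBox_of_dvd hr fun i => (h i).1, fun i => (h i).1⟩

/-! ### The inner sum `T(r,s)` and display (9.2) -/

/-- `∑_x ∑_y C (a_x b_y) = C (∑_x a_x)(∑_y b_y)`. [cite: Maynard2016DenseClusters, (9.2) p. 19 (interchange of summation)] -/
theorem sum_sum_const_mul_mul {α β : Type*} (s : Finset α) (t : Finset β) (a : α → ℝ) (b : β → ℝ)
    (C : ℝ) : ∑ x ∈ s, ∑ y ∈ t, C * (a x * b y) = C * ((∑ x ∈ s, a x) * ∑ y ∈ t, b y) := by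
  rw [Finset.sum_mul_sum, Finset.mul_sum]
  refine Finset.sum_congr rfl fun x _ => ?_
  rw [Finset.mul_sum]

/-- The inner sum of (9.2): `T(r,s) = ∑'_{d ∣ r, e ∣ s} μ(d)μ(e) d e/∏ᵢ[dᵢ,eᵢ]`, the sum over
coordinatewise divisors `d` of `r` and `e` of `s` in `𝒟_k(𝓛)` restricted to cross-coprime pairs
(`(dᵢeᵢ, dⱼeⱼ) = 1`, `i ≠ j`), with `d = ∏ dᵢ`. [cite: Maynard2016DenseClusters, (9.2) p. 19] -/
def localPairSum (L : Fin k → ℤ × ℤ) (B : ℕ) (R : ℝ) (r s : Fin k → ℕ) : ℝ :=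
  ∑ d ∈ (dkBox L B R).filter (fun d => ∀ i, d i ∣ r i),
    ∑ e ∈ (dkBox L B R).filter (fun e => ∀ i, e i ∣ s i),
      if ∀ i j, i ≠ j → (d i * e i).Coprime (d j * e j) then
        ((μ (∏ i, d i) : ℤ) : ℝ) * ((μ (∏ i, e i) : ℤ) : ℝ) * ((∏ i, (d i : ℝ)) * ∏ i, (e i : ℝ)) /
          ∏ i, ((Nat.lcm (d i) (e i) : ℕ) : ℝ)
      else 0

/-- **[Maynard2016DenseClusters, display (9.2) p. 19]** (any `F`): substituting (8.6)
`λ_d = μ(d) d ∑_{d∣r} y_r/φ_ω(r)`,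
`∑_{d,e ∈ 𝒟_k} [cross-coprime] λ_d λ_e/∏[dᵢ,eᵢ] = ∑_{r,s ∈ 𝒟_k} (y_r y_s/(φ_ω(r) φ_ω(s))) T(r,s)`.
[cite: Maynard2016DenseClusters, (9.2) p. 19, (8.6) p. 14; FordGreenKonyaginMaynardTao2018, (7.7) p. 21] -/
theorem quadForm_eq_sum_yVar (L : Fin k → ℤ × ℤ) (B : ℕ) (R : ℝ) (F : (Fin k → ℝ) → ℝ) :
    ∑ d ∈ dkBox L B R, ∑ e ∈ dkBox L B R,
        (if ∀ i j, i ≠ j → (d i * e i).Coprime (d j * e j) then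
          lamVar L B R F d * lamVar L B R F e / ∏ i, ((Nat.lcm (d i) (e i) : ℕ) : ℝ) else 0) =
      ∑ r ∈ dkBox L B R, ∑ s ∈ dkBox L B R,
        yVar L B R F r * yVar L B R F s / (phiOmega L (∏ i, r i) * phiOmega L (∏ i, s i)) *
          localPairSum L B R r s := by
  classical
  set box := dkBox L B R with hbox
  -- the common 4-variable summand
  set g : (Fin k → ℕ) → (Fin k → ℕ) → (Fin k → ℕ) → (Fin k → ℕ) → ℝ := fun d e r s =>
    (if ∀ i j, i ≠ j → (d i * e i).Coprime (d j * e j) then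
        ((μ (∏ i, d i) : ℤ) : ℝ) * ((μ (∏ i, e i) : ℤ) : ℝ) * ((∏ i, (d i : ℝ)) * ∏ i, (e i : ℝ)) /
          ∏ i, ((Nat.lcm (d i) (e i) : ℕ) : ℝ)
      else 0) *
      ((if ∀ i, d i ∣ r i then yVar L B R F r / phiOmega L (∏ i, r i) else 0) *
        (if ∀ i, e i ∣ s i then yVar L B R F s / phiOmega L (∏ i, s i) else 0)) with hg
  -- LHS summand = ∑_r ∑_s g d e r s
  have hL : ∀ d ∈ box, ∀ e ∈ box,
      (if ∀ i j, i ≠ j → (d i * e i).Coprime (d j * e j) then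
          lamVar L B R F d * lamVar L B R F e / ∏ i, ((Nat.lcm (d i) (e i) : ℕ) : ℝ) else 0) =
        ∑ r ∈ box, ∑ s ∈ box, g d e r s := by
    intro d _ e _
    have hSd : ∑ r ∈ box.filter (fun r => ∀ i, d i ∣ r i), yVar L B R F r / phiOmega L (∏ i, r i) =
        ∑ r ∈ box, (if ∀ i, d i ∣ r i then yVar L B R F r / phiOmega L (∏ i, r i) else 0) :=
      Finset.sum_filter _ _
    have hSe : ∑ s ∈ box.filter (fun s => ∀ i, e i ∣ s i), yVar L B R F s / phiOmega L (∏ i, s i) =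
        ∑ s ∈ box, (if ∀ i, e i ∣ s i then yVar L B R F s / phiOmega L (∏ i, s i) else 0) :=
      Finset.sum_filter _ _
    split_ifs with hP
    · unfold lamVar
      rw [hSd, hSe]
      simp only [hg, if_pos hP]
      rw [sum_sum_const_mul_mul]
      ring
    · symm
      refine Finset.sum_eq_zero fun r _ => Finset.sum_eq_zero fun s _ => ?_
      simp only [hg, if_neg hP, zero_mul]
  -- RHS summand = ∑_d ∑_e g d e r s
  have hR : ∀ r ∈ box, ∀ s ∈ box,
      yVar L B R F r * yVar L B R F s / (phiOmega L (∏ i, r i) * phiOmega L (∏ i, s i)) *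
          localPairSum L B R r s = ∑ d ∈ box, ∑ e ∈ box, g d e r s := by
    intro r _ s _
    unfold localPairSum
    rw [Finset.sum_filter, Finset.mul_sum]
    refine Finset.sum_congr rfl fun d _ => ?_
    split_ifs with hdr
    · rw [Finset.sum_filter, Finset.mul_sum]
      refine Finset.sum_congr rfl fun e _ => ?_
      split_ifs with hes hP
      · simp only [hg, if_pos hP, if_pos hdr, if_pos hes]; ring
      · simp only [hg, if_neg hP, zero_mul, mul_zero]
      · simp only [hg, if_neg hes, mul_zero]
    · rw [mul_zero]; symm
      refine Finset.sum_eq_zero fun e _ => ?_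
      simp only [hg, if_neg hdr, zero_mul, mul_zero]
  rw [Finset.sum_congr rfl fun d hd => Finset.sum_congr rfl fun e he => hL d hd e he,
    Finset.sum_congr rfl fun r hr => Finset.sum_congr rfl fun s hs => hR r hr s hs]
  -- ∑_d ∑_e ∑_r ∑_s = ∑_r ∑_s ∑_d ∑_e
  calc ∑ d ∈ box, ∑ e ∈ box, ∑ r ∈ box, ∑ s ∈ box, g d e r s
      = ∑ d ∈ box, ∑ r ∈ box, ∑ e ∈ box, ∑ s ∈ box, g d e r s :=
        Finset.sum_congr rfl fun d _ => Finset.sum_comm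
    _ = ∑ r ∈ box, ∑ d ∈ box, ∑ e ∈ box, ∑ s ∈ box, g d e r s := Finset.sum_comm
    _ = ∑ r ∈ box, ∑ d ∈ box, ∑ s ∈ box, ∑ e ∈ box, g d e r s :=
        Finset.sum_congr rfl fun r _ => Finset.sum_congr rfl fun d _ => Finset.sum_comm
    _ = ∑ r ∈ box, ∑ s ∈ box, ∑ d ∈ box, ∑ e ∈ box, g d e r s :=
        Finset.sum_congr rfl fun r _ => Finset.sum_comm

end Literature.NumberTheory.Sieve.FGKMT2018
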